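import Summits.QuantumFields.YangMills.Theorems.ColdStartUniversalityLatticeLangevinMartingaleIncrements
import HarnessLib

/-!
# Route `ColdStartUniversality` (fixed-cut-off SZZ dynamics, sampler package): the AZUMA–HOEFFDING MAXIMAL INEQUALITY in elementary form —
# `P[max_(k≤N) S_k ≥ r] ≤ exp(−r²/(2NB²))` for bounded increments orthogonal to their past σ-algebras

Helper file (seat `ym-line-csu-p1`, g34; `--supports stmt-QuantumFields-24809`).  Generic probability, no SZZ object; the maximal companion of
file 68.  Setting: a probability space, an increasing family of σ-algebras `ℱ₀ ≤ ℱ₁ ≤ ⋯ ≤ mΩ`, real increments `D_k` with `|D_k| ≤ B`, `D_k`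
`ℱ_(k+1)`-measurable, and ORTHOGONAL TO THE PAST: `∫ Z·D_k dP = 0` for every bounded non-negative `ℱ_k`-measurable `Z` (`k < N`) — what the
Markov property delivers for the increments of the Poisson/Dynkin martingale of the SZZ sampler, on an arbitrary probability space and without
conditional expectations.  With `S_k = D₀ + ⋯ + D_(k−1)`:
* `integral_mul_le_integral_mul_exp_of_orthogonal` — LOWER companion of file 68's Hoeffding step: `∫ Z ≤ ∫ Z·e^(λD)` (`e^x ≥ 1 + x`);
* ★ `integral_mul_le_integral_mul_exp_sum_Ico` — `∫ Z ≤ ∫ Z·e^(λ(S_n − S_j))` for `Z ≥ 0` bounded `ℱ_j`-measurable, `j ≤ n ≤ N`;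
* ★ `integral_exp_mul_sum_le_of_orthogonal_past` — `E e^(λS_N) ≤ e^(Nλ²B²/2)` (file 68 applies);
* ★★★ `measureReal_exists_sum_ge_le_of_orthogonal` — **the maximal inequality `P[∃ k ≤ N, S_k ≥ r] ≤ exp(−r²/(2NB²))`** (first-passage
  decomposition `E_j = {S_j ≥ r, S_i < r (i<j)}`, `e^(λr)P(E_j) ≤ ∫ 1_(E_j) e^(λS_N)`, disjointness, Chernoff);
* ★★★ `measureReal_exists_abs_sum_ge_le_of_orthogonal` — two-sided: `P[∃ k ≤ N, |S_k| ≥ r] ≤ 2·exp(−r²/(2NB²))`.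
THEOREMS ONLY, no definition, no sorry; [folklore] (Azuma 1967 / Hoeffding 1963, maximal form via Doob's first-passage argument).  HONEST FRAMING:
plumbing for fixed-cut-off sampler statements; `UniformColdStartMixing` (24809) is NOT restated; no crux, rung or summit statement is proved; the
Yang–Mills mass gap is NOT proved.
-/

set_option autoImplicit false

noncomputable section

namespace Summit.QuantumFields.YangMills.Theorems.ColdStartUniversality

open MeasureTheory ProbabilityTheory Filter Finset
open scoped NNReal ENNReal BigOperators

variable {Ω : Type*} {mΩ : MeasurableSpace Ω} {P : Measure Ω}

/-! ## §1. The lower Hoeffding step and its iteration -/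

/-- **Lower companion of the Hoeffding step**: `Z ≥ 0` bounded measurable, `D` bounded measurable, `∫ Z·D = 0` ⇒ `∫ Z ≤ ∫ Z·e^(λD)`
(`e^x ≥ 1 + x`). [folklore] -/
theorem integral_mul_le_integral_mul_exp_of_orthogonal [IsFiniteMeasure P] {Z D : Ω → ℝ}
    (hZm : Measurable Z) (hDm : Measurable D) {CZ B : ℝ} (hZ0 : ∀ ω, 0 ≤ Z ω) (hZb : ∀ ω, Z ω ≤ CZ)
    (hDb : ∀ ω, |D ω| ≤ B) (horth : ∫ ω, Z ω * D ω ∂P = 0) (l : ℝ) :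
    ∫ ω, Z ω ∂P ≤ ∫ ω, Z ω * Real.exp (l * D ω) ∂P := by
  have hbdd : ∀ {φ : Ω → ℝ} {C : ℝ}, Measurable φ → (∀ ω, |φ ω| ≤ C) → Integrable (fun ω => Z ω * φ ω) P :=
    fun {φ C} hφ hφb => (integrable_const (CZ * C)).mono' (hZm.mul hφ).aestronglyMeasurable
      (Eventually.of_forall fun ω => by
        rw [norm_mul, Real.norm_eq_abs, Real.norm_eq_abs, abs_of_nonneg (hZ0 ω)]
        exact mul_le_mul (hZb ω) (hφb ω) (abs_nonneg _) ((hZ0 ω).trans (hZb ω)))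
  have hZi : Integrable Z P := by
    have h := hbdd (measurable_const (a := (1 : ℝ))) (fun _ => (abs_one.le : |(1 : ℝ)| ≤ 1))
    simpa using h
  have hZDi : Integrable (fun ω => Z ω * D ω) P := hbdd hDm hDb
  have hEb : ∀ ω, |Real.exp (l * D ω)| ≤ Real.exp (|l| * B) := fun ω => by
    rw [abs_of_pos (Real.exp_pos _), Real.exp_le_exp]
    calc l * D ω ≤ |l * D ω| := le_abs_self _
      _ = |l| * |D ω| := abs_mul _ _
      _ ≤ |l| * B := mul_le_mul_of_nonneg_left (hDb ω) (abs_nonneg l)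
  have hZEi : Integrable (fun ω => Z ω * Real.exp (l * D ω)) P := hbdd (hDm.const_mul l).exp hEb
  calc ∫ ω, Z ω ∂P = (∫ ω, Z ω ∂P) + l * ∫ ω, Z ω * D ω ∂P := by rw [horth, mul_zero, add_zero]
    _ = ∫ ω, (Z ω + l * (Z ω * D ω)) ∂P := by rw [integral_add hZi (hZDi.const_mul l), integral_const_mul]
    _ ≤ ∫ ω, Z ω * Real.exp (l * D ω) ∂P := by
        refine integral_mono (hZi.add (hZDi.const_mul l)) hZEi fun ω => ?_
        have h1 := Real.add_one_le_exp (l * D ω)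
        have h2 : Z ω + l * (Z ω * D ω) = Z ω * (l * D ω + 1) := by ring
        rw [h2]
        exact mul_le_mul_of_nonneg_left h1 (hZ0 ω)

variable [IsProbabilityMeasure P]

/-- ★ **Iterated lower step**: with increments `D_i` (`|D_i| ≤ B`, `D_i` `ℱ_(i+1)`-measurable, `ℱ` increasing, `ℱ_k ≤ mΩ`) orthogonal to every
bounded non-negative `ℱ_k`-measurable weight for `k < N`, every bounded `Z ≥ 0` that is `ℱ_j`-measurable satisfies
`∫ Z ≤ ∫ Z·e^(λ Σ_(i∈[j,n)) D_i)` for `j ≤ n ≤ N`. [folklore] -/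
theorem integral_mul_le_integral_mul_exp_sum_Ico (ℱ : ℕ → MeasurableSpace Ω) (hℱle : ∀ k, ℱ k ≤ mΩ) (hℱmono : Monotone ℱ)
    (D : ℕ → Ω → ℝ) (hDF : ∀ k, Measurable[ℱ (k + 1)] (D k)) {B : ℝ} (hDb : ∀ k ω, |D k ω| ≤ B) (N : ℕ)
    (horth : ∀ k < N, ∀ (Z : Ω → ℝ), Measurable[ℱ k] Z → (∀ ω, 0 ≤ Z ω) → (∃ CZ : ℝ, ∀ ω, Z ω ≤ CZ) →
      ∫ ω, Z ω * D k ω ∂P = 0)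
    {j : ℕ} {Z : Ω → ℝ} (hZF : Measurable[ℱ j] Z) (hZ0 : ∀ ω, 0 ≤ Z ω) {CZ : ℝ} (hZb : ∀ ω, Z ω ≤ CZ) (l : ℝ)
    {n : ℕ} (hjn : j ≤ n) (hnN : n ≤ N) :
    ∫ ω, Z ω ∂P ≤ ∫ ω, Z ω * Real.exp (l * ∑ i ∈ Finset.Ico j n, D i ω) ∂P := by
  induction n, hjn using Nat.le_induction with
  | base => simp
  | succ n hjn ih =>
    have ih' := ih (Nat.le_of_succ_le hnN)
    have hDm : ∀ k, Measurable (D k) := fun k => (hDF k).mono (hℱle _) le_rfl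
    -- the weight `Z' = Z e^(λ Σ_[j,n) D_i)` is `ℱ_n`-measurable, non-negative and bounded
    have hSF : Measurable[ℱ n] fun ω => ∑ i ∈ Finset.Ico j n, D i ω := by
      refine Finset.measurable_sum _ fun i hi => ?_
      exact (hDF i).mono (hℱmono (Nat.succ_le_of_lt (Finset.mem_Ico.1 hi).2)) le_rfl
    have hZ'F : Measurable[ℱ n] fun ω => Z ω * Real.exp (l * ∑ i ∈ Finset.Ico j n, D i ω) :=
      (hZF.mono (hℱmono hjn) le_rfl).mul (hSF.const_mul l).exp
    have hZ'm : Measurable fun ω => Z ω * Real.exp (l * ∑ i ∈ Finset.Ico j n, D i ω) := hZ'F.mono (hℱle n) le_rfl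
    have hSb : ∀ ω, |∑ i ∈ Finset.Ico j n, D i ω| ≤ (n - j : ℕ) * B := fun ω =>
      (Finset.abs_sum_le_sum_abs _ _).trans (by
        calc ∑ i ∈ Finset.Ico j n, |D i ω| ≤ ∑ _i ∈ Finset.Ico j n, B := Finset.sum_le_sum fun i _ => hDb i ω
          _ = (n - j : ℕ) * B := by rw [Finset.sum_const, Nat.card_Ico, nsmul_eq_mul])
    have hZ'0 : ∀ ω, 0 ≤ Z ω * Real.exp (l * ∑ i ∈ Finset.Ico j n, D i ω) := fun ω => mul_nonneg (hZ0 ω) (Real.exp_pos _).le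
    have hZ'b : ∀ ω, Z ω * Real.exp (l * ∑ i ∈ Finset.Ico j n, D i ω) ≤ CZ * Real.exp (|l| * ((n - j : ℕ) * B)) := fun ω => by
      refine mul_le_mul (hZb ω) ?_ (Real.exp_pos _).le ((hZ0 ω).trans (hZb ω))
      rw [Real.exp_le_exp]
      calc l * ∑ i ∈ Finset.Ico j n, D i ω ≤ |l * ∑ i ∈ Finset.Ico j n, D i ω| := le_abs_self _
        _ = |l| * |∑ i ∈ Finset.Ico j n, D i ω| := abs_mul _ _
        _ ≤ |l| * ((n - j : ℕ) * B) := mul_le_mul_of_nonneg_left (hSb ω) (abs_nonneg l)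
    have hstep := integral_mul_le_integral_mul_exp_of_orthogonal hZ'm (hDm n) hZ'0 hZ'b (hDb n)
      (horth n (Nat.lt_of_succ_le hnN) _ hZ'F hZ'0 ⟨_, hZ'b⟩) l
    refine ih'.trans (hstep.trans (le_of_eq (integral_congr_ae (ae_of_all _ fun ω => ?_))))
    show Z ω * Real.exp (l * ∑ i ∈ Finset.Ico j n, D i ω) * Real.exp (l * D n ω) = Z ω * Real.exp (l * ∑ i ∈ Finset.Ico j (n + 1), D i ω)
    rw [Finset.sum_Ico_succ_top hjn, mul_add, Real.exp_add, mul_assoc]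

/-- ★ **Sub-Gaussian moment generating function under orthogonality to the past**: `E e^(λ S_N) ≤ e^(N λ² B²/2)` (file 68 with the weights
`e^(λ S_k)`, which are `ℱ_k`-measurable, non-negative and bounded). [folklore] -/
theorem integral_exp_mul_sum_le_of_orthogonal_past (ℱ : ℕ → MeasurableSpace Ω) (hℱle : ∀ k, ℱ k ≤ mΩ) (hℱmono : Monotone ℱ)
    (D : ℕ → Ω → ℝ) (hDF : ∀ k, Measurable[ℱ (k + 1)] (D k)) {B : ℝ} (hB : 0 < B) (hDb : ∀ k ω, |D k ω| ≤ B) (N : ℕ)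
    (horth : ∀ k < N, ∀ (Z : Ω → ℝ), Measurable[ℱ k] Z → (∀ ω, 0 ≤ Z ω) → (∃ CZ : ℝ, ∀ ω, Z ω ≤ CZ) →
      ∫ ω, Z ω * D k ω ∂P = 0) (l : ℝ) :
    ∫ ω, Real.exp (l * ∑ j ∈ Finset.range N, D j ω) ∂P ≤ Real.exp (N * (l ^ 2 * B ^ 2 / 2)) := by
  have hDm : ∀ k, Measurable (D k) := fun k => (hDF k).mono (hℱle _) le_rfl
  refine integral_exp_mul_sum_le_of_orthogonal D hDm hB hDb N (fun k hk l' => ?_) l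
  have hSF : Measurable[ℱ k] fun ω => ∑ i ∈ Finset.range k, D i ω := by
    refine Finset.measurable_sum _ fun i hi => ?_
    exact (hDF i).mono (hℱmono (Nat.succ_le_of_lt (Finset.mem_range.1 hi))) le_rfl
  have hSb : ∀ ω, |∑ i ∈ Finset.range k, D i ω| ≤ k * B := fun ω =>
    (Finset.abs_sum_le_sum_abs _ _).trans (by
      calc ∑ i ∈ Finset.range k, |D i ω| ≤ ∑ _i ∈ Finset.range k, B := Finset.sum_le_sum fun i _ => hDb i ω
        _ = k * B := by rw [Finset.sum_const, Finset.card_range, nsmul_eq_mul])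
  refine horth k hk _ (hSF.const_mul l').exp (fun ω => (Real.exp_pos _).le) ⟨Real.exp (|l'| * (k * B)), fun ω => ?_⟩
  rw [Real.exp_le_exp]
  calc l' * ∑ i ∈ Finset.range k, D i ω ≤ |l' * ∑ i ∈ Finset.range k, D i ω| := le_abs_self _
    _ = |l'| * |∑ i ∈ Finset.range k, D i ω| := abs_mul _ _
    _ ≤ |l'| * (k * B) := mul_le_mul_of_nonneg_left (hSb ω) (abs_nonneg l')

/-! ## §2. The maximal inequality -/

/-- ★★★ **Azuma–Hoeffding maximal inequality (one-sided)** under orthogonality to the past: for `r ≥ 0`,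
`P[∃ k ≤ N, S_k ≥ r] ≤ exp(−r²/(2NB²))`. [folklore] -/
theorem measureReal_exists_sum_ge_le_of_orthogonal (ℱ : ℕ → MeasurableSpace Ω) (hℱle : ∀ k, ℱ k ≤ mΩ) (hℱmono : Monotone ℱ)
    (D : ℕ → Ω → ℝ) (hDF : ∀ k, Measurable[ℱ (k + 1)] (D k)) {B : ℝ} (hB : 0 < B) (hDb : ∀ k ω, |D k ω| ≤ B) (N : ℕ)
    (horth : ∀ k < N, ∀ (Z : Ω → ℝ), Measurable[ℱ k] Z → (∀ ω, 0 ≤ Z ω) → (∃ CZ : ℝ, ∀ ω, Z ω ≤ CZ) →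
      ∫ ω, Z ω * D k ω ∂P = 0) {r : ℝ} (hr : 0 ≤ r) :
    P.real {ω | ∃ k, k ≤ N ∧ r ≤ ∑ i ∈ Finset.range k, D i ω} ≤ Real.exp (-r ^ 2 / (2 * (N * B ^ 2))) := by
  classical
  have hDm : ∀ k, Measurable (D k) := fun k => (hDF k).mono (hℱle _) le_rfl
  set S : ℕ → Ω → ℝ := fun k ω => ∑ i ∈ Finset.range k, D i ω with hS
  have hSF : ∀ j k, j ≤ k → Measurable[ℱ k] (S j) := fun j k hjk => by
    refine Finset.measurable_sum _ fun i hi => ?_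
    exact (hDF i).mono (hℱmono ((Nat.succ_le_of_lt (Finset.mem_range.1 hi)).trans hjk)) le_rfl
  have hSm : ∀ j, Measurable (S j) := fun j => (hSF j j le_rfl).mono (hℱle j) le_rfl
  -- the case `N = 0`: the event is `{r ≤ 0}`
  rcases Nat.eq_zero_or_pos N with hN0 | hNpos
  · subst hN0
    rcases eq_or_lt_of_le hr with hr0 | hr0
    · refine measureReal_le_one.trans ?_
      rw [← hr0]; simp
    · have hempty : {ω | ∃ k, k ≤ 0 ∧ r ≤ ∑ i ∈ Finset.range k, D i ω} = ∅ := by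
        refine Set.eq_empty_iff_forall_notMem.2 fun ω hω => ?_
        obtain ⟨k, hk, hrk⟩ := hω
        rw [Nat.le_zero.1 hk, Finset.sum_range_zero] at hrk
        linarith
      rw [hempty, measureReal_empty]
      positivity
  have hNr : (0 : ℝ) < N := by exact_mod_cast hNpos
  -- first-passage events
  set E : ℕ → Set Ω := fun j => {ω | r ≤ S j ω ∧ ∀ i < j, S i ω < r} with hE
  have hEF : ∀ j, MeasurableSet[ℱ j] (E j) := fun j => by
    have h1 : MeasurableSet[ℱ j] {ω | r ≤ S j ω} := measurableSet_le (measurable_const (a := r)) (hSF j j le_rfl)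
    have h2 : MeasurableSet[ℱ j] (⋂ i ∈ Finset.range j, {ω | S i ω < r}) :=
      Finset.measurableSet_biInter _ fun i hi => measurableSet_lt (hSF i j (Finset.mem_range.1 hi).le) measurable_const
    have h3 : E j = {ω | r ≤ S j ω} ∩ ⋂ i ∈ Finset.range j, {ω | S i ω < r} := by
      ext ω; simp [hE, Set.mem_iInter]
    rw [h3]
    exact h1.inter h2
  have hEm : ∀ j, MeasurableSet (E j) := fun j => hℱle j _ (hEF j)
  have hdisj : (↑(Finset.range (N + 1)) : Set ℕ).PairwiseDisjoint E := by
    intro i _ j _ hij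
    rcases lt_or_gt_of_ne hij with h | h
    · exact Set.disjoint_left.2 fun ω hi hj => absurd hi.1 (not_le.2 (hj.2 i h))
    · exact Set.disjoint_left.2 fun ω hi hj => absurd hj.1 (not_le.2 (hi.2 j h))
  have hunion : {ω | ∃ k, k ≤ N ∧ r ≤ ∑ i ∈ Finset.range k, D i ω} = ⋃ j ∈ Finset.range (N + 1), E j := by
    ext ω
    simp only [Set.mem_setOf_eq, Set.mem_iUnion, Finset.mem_range, exists_prop]
    constructor
    · rintro ⟨k, hk, hrk⟩
      have hex : ∃ j, r ≤ S j ω := ⟨k, hrk⟩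
      refine ⟨Nat.find hex, Nat.lt_succ_of_le ((Nat.find_le hrk).trans hk), Nat.find_spec hex, fun i hi => ?_⟩
      exact not_le.1 (Nat.find_min hex hi)
    · rintro ⟨j, hj, hrj, -⟩
      exact ⟨j, Nat.le_of_lt_succ hj, hrj⟩
  -- Chernoff parameter
  set l : ℝ := r / (N * B ^ 2) with hl
  have hl0 : 0 ≤ l := by positivity
  -- `e^(λr) P(E_j) ≤ ∫ 1_(E_j) e^(λ S_N)`
  have hstep : ∀ j ∈ Finset.range (N + 1),
      Real.exp (l * r) * P.real (E j) ≤ ∫ ω, (E j).indicator (fun _ => (1 : ℝ)) ω * Real.exp (l * S N ω) ∂P := by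
    intro j hj
    have hjN : j ≤ N := Nat.le_of_lt_succ (Finset.mem_range.1 hj)
    -- the weight `Z = 1_(E_j) e^(λ S_j)`
    set Z : Ω → ℝ := fun ω => (E j).indicator (fun _ => (1 : ℝ)) ω * Real.exp (l * S j ω) with hZ
    have hZF : Measurable[ℱ j] Z := ((measurable_const (a := (1 : ℝ))).indicator (hEF j)).mul ((hSF j j le_rfl).const_mul l).exp
    have hZ0 : ∀ ω, 0 ≤ Z ω := fun ω => mul_nonneg (Set.indicator_nonneg (fun _ _ => zero_le_one) _) (Real.exp_pos _).le
    have hSjb : ∀ ω, |S j ω| ≤ j * B := fun ω =>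
      (Finset.abs_sum_le_sum_abs _ _).trans (by
        calc ∑ i ∈ Finset.range j, |D i ω| ≤ ∑ _i ∈ Finset.range j, B := Finset.sum_le_sum fun i _ => hDb i ω
          _ = j * B := by rw [Finset.sum_const, Finset.card_range, nsmul_eq_mul])
    have hZb : ∀ ω, Z ω ≤ Real.exp (|l| * (j * B)) := fun ω => by
      have h1 : (E j).indicator (fun _ => (1 : ℝ)) ω ≤ 1 := Set.indicator_le' (fun _ _ => le_rfl) (fun _ _ => zero_le_one) ω
      refine (mul_le_mul_of_nonneg_right h1 (Real.exp_pos _).le).trans ?_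
      rw [one_mul, Real.exp_le_exp]
      calc l * S j ω ≤ |l * S j ω| := le_abs_self _
        _ = |l| * |S j ω| := abs_mul _ _
        _ ≤ |l| * (j * B) := mul_le_mul_of_nonneg_left (hSjb ω) (abs_nonneg l)
    have hlow := integral_mul_le_integral_mul_exp_sum_Ico ℱ hℱle hℱmono D hDF hDb N horth hZF hZ0 hZb l hjN le_rfl
    -- `e^(λ r) 1_(E_j) ≤ Z` pointwise
    have hpt : ∀ ω, Real.exp (l * r) * (E j).indicator (fun _ => (1 : ℝ)) ω ≤ Z ω := fun ω => by
      by_cases hω : ω ∈ E j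
      · simp only [hZ, Set.indicator_of_mem hω, mul_one, one_mul]
        exact Real.exp_le_exp.2 (mul_le_mul_of_nonneg_left hω.1 hl0)
      · simp [hZ, Set.indicator_of_notMem hω]
    have hZm : Measurable Z := hZF.mono (hℱle j) le_rfl
    have hZi : Integrable Z P := (integrable_const (Real.exp (|l| * (j * B)))).mono' hZm.aestronglyMeasurable
      (Eventually.of_forall fun ω => by rw [Real.norm_eq_abs, abs_of_nonneg (hZ0 ω)]; exact hZb ω)
    have hIi : Integrable (fun ω => Real.exp (l * r) * (E j).indicator (fun _ => (1 : ℝ)) ω) P :=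
      ((integrable_const (1 : ℝ)).indicator (hEm j)).const_mul _
    -- `∫ Z e^(λ(S_N − S_j)) = ∫ 1_(E_j) e^(λ S_N)`
    have hprod : ∀ ω, Z ω * Real.exp (l * ∑ i ∈ Finset.Ico j N, D i ω) = (E j).indicator (fun _ => (1 : ℝ)) ω * Real.exp (l * S N ω) := by
      intro ω
      simp only [hZ, hS]
      rw [mul_assoc, ← Real.exp_add, ← mul_add, Finset.sum_range_add_sum_Ico _ hjN]
    calc Real.exp (l * r) * P.real (E j) = ∫ ω, Real.exp (l * r) * (E j).indicator (fun _ => (1 : ℝ)) ω ∂P := by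
          rw [integral_const_mul, integral_indicator (hEm j), setIntegral_const, smul_eq_mul, mul_one]
      _ ≤ ∫ ω, Z ω ∂P := integral_mono hIi hZi hpt
      _ ≤ ∫ ω, Z ω * Real.exp (l * ∑ i ∈ Finset.Ico j N, D i ω) ∂P := hlow
      _ = ∫ ω, (E j).indicator (fun _ => (1 : ℝ)) ω * Real.exp (l * S N ω) ∂P := integral_congr_ae (ae_of_all _ hprod)
  -- sum over `j`: `e^(λr) P(⋃ E_j) ≤ ∫ 1_(⋃E_j) e^(λS_N) ≤ E e^(λ S_N) ≤ e^(Nλ²B²/2)`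
  have hexpSN : Integrable (fun ω => Real.exp (l * S N ω)) P := by
    have hSNb : ∀ ω, |S N ω| ≤ N * B := fun ω =>
      (Finset.abs_sum_le_sum_abs _ _).trans (by
        calc ∑ i ∈ Finset.range N, |D i ω| ≤ ∑ _i ∈ Finset.range N, B := Finset.sum_le_sum fun i _ => hDb i ω
          _ = N * B := by rw [Finset.sum_const, Finset.card_range, nsmul_eq_mul])
    refine (integrable_const (Real.exp (|l| * (N * B)))).mono' ((hSm N).const_mul l).exp.aestronglyMeasurable
      (Eventually.of_forall fun ω => ?_)
    rw [Real.norm_eq_abs, abs_of_pos (Real.exp_pos _), Real.exp_le_exp]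
    calc l * S N ω ≤ |l * S N ω| := le_abs_self _
      _ = |l| * |S N ω| := abs_mul _ _
      _ ≤ |l| * (N * B) := mul_le_mul_of_nonneg_left (hSNb ω) (abs_nonneg l)
  have hSNb : ∀ ω, |S N ω| ≤ N * B := fun ω =>
    (Finset.abs_sum_le_sum_abs _ _).trans (by
      calc ∑ i ∈ Finset.range N, |D i ω| ≤ ∑ _i ∈ Finset.range N, B := Finset.sum_le_sum fun i _ => hDb i ω
        _ = N * B := by rw [Finset.sum_const, Finset.card_range, nsmul_eq_mul])
  have hexpb : ∀ ω, |Real.exp (l * S N ω)| ≤ Real.exp (|l| * (N * B)) := fun ω => by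
    rw [abs_of_pos (Real.exp_pos _), Real.exp_le_exp]
    calc l * S N ω ≤ |l * S N ω| := le_abs_self _
      _ = |l| * |S N ω| := abs_mul _ _
      _ ≤ |l| * (N * B) := mul_le_mul_of_nonneg_left (hSNb ω) (abs_nonneg l)
  have hIj : ∀ j ∈ Finset.range (N + 1), Integrable (fun ω => (E j).indicator (fun _ => (1 : ℝ)) ω * Real.exp (l * S N ω)) P :=
    fun j _ => (integrable_const (1 * Real.exp (|l| * (N * B)))).mono'
      (((measurable_const (a := (1 : ℝ))).indicator (hEm j)).mul ((hSm N).const_mul l).exp).aestronglyMeasurable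
      (Eventually.of_forall fun ω => by
        rw [norm_mul, Real.norm_eq_abs, Real.norm_eq_abs]
        refine mul_le_mul ?_ (hexpb ω) (abs_nonneg _) zero_le_one
        rw [abs_of_nonneg (Set.indicator_nonneg (fun _ _ => zero_le_one) _)]
        exact Set.indicator_le' (fun _ _ => le_rfl) (fun _ _ => zero_le_one) ω)
  have hptsum : ∀ ω, ∑ j ∈ Finset.range (N + 1), (E j).indicator (fun _ => (1 : ℝ)) ω * Real.exp (l * S N ω) ≤ Real.exp (l * S N ω) := by
    intro ω
    rw [← Finset.sum_mul]
    have h1 : ∑ j ∈ Finset.range (N + 1), (E j).indicator (fun _ => (1 : ℝ)) ω =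
        (⋃ j ∈ Finset.range (N + 1), E j).indicator (fun _ => (1 : ℝ)) ω := by
      rw [Finset.indicator_biUnion _ _ hdisj]
    rw [h1]
    have h2 : (⋃ j ∈ Finset.range (N + 1), E j).indicator (fun _ => (1 : ℝ)) ω ≤ 1 :=
      Set.indicator_le' (fun _ _ => le_rfl) (fun _ _ => zero_le_one) ω
    calc (⋃ j ∈ Finset.range (N + 1), E j).indicator (fun _ => (1 : ℝ)) ω * Real.exp (l * S N ω) ≤ 1 * Real.exp (l * S N ω) :=
          mul_le_mul_of_nonneg_right h2 (Real.exp_pos _).le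
      _ = Real.exp (l * S N ω) := one_mul _
  have hsum : Real.exp (l * r) * P.real (⋃ j ∈ Finset.range (N + 1), E j) ≤ ∫ ω, Real.exp (l * S N ω) ∂P := by
    calc Real.exp (l * r) * P.real (⋃ j ∈ Finset.range (N + 1), E j)
        = ∑ j ∈ Finset.range (N + 1), Real.exp (l * r) * P.real (E j) := by
          rw [measureReal_biUnion_finset hdisj (fun j _ => hEm j), Finset.mul_sum]
      _ ≤ ∑ j ∈ Finset.range (N + 1), ∫ ω, (E j).indicator (fun _ => (1 : ℝ)) ω * Real.exp (l * S N ω) ∂P := Finset.sum_le_sum hstep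
      _ = ∫ ω, ∑ j ∈ Finset.range (N + 1), (E j).indicator (fun _ => (1 : ℝ)) ω * Real.exp (l * S N ω) ∂P := (integral_finsetSum _ hIj).symm
      _ ≤ ∫ ω, Real.exp (l * S N ω) ∂P := integral_mono (integrable_finsetSum _ hIj) hexpSN hptsum
  have hmgf := integral_exp_mul_sum_le_of_orthogonal_past ℱ hℱle hℱmono D hDF hB hDb N horth l
  -- Chernoff
  rw [hunion]
  have hfin : P.real (⋃ j ∈ Finset.range (N + 1), E j) ≤ Real.exp (-(l * r)) * Real.exp (N * (l ^ 2 * B ^ 2 / 2)) := by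
    rw [Real.exp_neg, ← div_eq_inv_mul, le_div_iff₀ (Real.exp_pos _), mul_comm]
    exact hsum.trans hmgf
  refine hfin.trans (le_of_eq ?_)
  rw [← Real.exp_add, hl]
  congr 1
  field_simp
  ring

/-- ★★★ **Azuma–Hoeffding maximal inequality (two-sided)** under orthogonality to the past: for `r ≥ 0`,
`P[∃ k ≤ N, |S_k| ≥ r] ≤ 2·exp(−r²/(2NB²))`. [folklore] -/
theorem measureReal_exists_abs_sum_ge_le_of_orthogonal (ℱ : ℕ → MeasurableSpace Ω) (hℱle : ∀ k, ℱ k ≤ mΩ) (hℱmono : Monotone ℱ)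
    (D : ℕ → Ω → ℝ) (hDF : ∀ k, Measurable[ℱ (k + 1)] (D k)) {B : ℝ} (hB : 0 < B) (hDb : ∀ k ω, |D k ω| ≤ B) (N : ℕ)
    (horth : ∀ k < N, ∀ (Z : Ω → ℝ), Measurable[ℱ k] Z → (∀ ω, 0 ≤ Z ω) → (∃ CZ : ℝ, ∀ ω, Z ω ≤ CZ) →
      ∫ ω, Z ω * D k ω ∂P = 0) {r : ℝ} (hr : 0 ≤ r) :
    P.real {ω | ∃ k, k ≤ N ∧ r ≤ |∑ i ∈ Finset.range k, D i ω|} ≤ 2 * Real.exp (-r ^ 2 / (2 * (N * B ^ 2))) := by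
  have h₁ := measureReal_exists_sum_ge_le_of_orthogonal ℱ hℱle hℱmono D hDF hB hDb N horth hr
  have hDF' : ∀ k, Measurable[ℱ (k + 1)] (fun ω => -D k ω) := fun k => (hDF k).neg
  have hDb' : ∀ k ω, |(-D k ω)| ≤ B := fun k ω => by rw [abs_neg]; exact hDb k ω
  have horth' : ∀ k < N, ∀ (Z : Ω → ℝ), Measurable[ℱ k] Z → (∀ ω, 0 ≤ Z ω) → (∃ CZ : ℝ, ∀ ω, Z ω ≤ CZ) →
      ∫ ω, Z ω * -D k ω ∂P = 0 := by
    intro k hk Z hZ hZ0 hZb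
    have h := horth k hk Z hZ hZ0 hZb
    have heq : ∀ ω, Z ω * -D k ω = -(Z ω * D k ω) := fun ω => by ring
    rw [integral_congr_ae (ae_of_all _ heq), integral_neg, h, neg_zero]
  have h₂ := measureReal_exists_sum_ge_le_of_orthogonal ℱ hℱle hℱmono (fun k ω => -D k ω) hDF' hB hDb' N horth' hr
  have hsub : {ω | ∃ k, k ≤ N ∧ r ≤ |∑ i ∈ Finset.range k, D i ω|} ⊆
      {ω | ∃ k, k ≤ N ∧ r ≤ ∑ i ∈ Finset.range k, D i ω} ∪ {ω | ∃ k, k ≤ N ∧ r ≤ ∑ i ∈ Finset.range k, -D i ω} := by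
    rintro ω ⟨k, hk, hrk⟩
    simp only [Set.mem_union, Set.mem_setOf_eq]
    rcases le_total 0 (∑ i ∈ Finset.range k, D i ω) with h0 | h0
    · left; exact ⟨k, hk, by rwa [abs_of_nonneg h0] at hrk⟩
    · right; refine ⟨k, hk, ?_⟩; rw [Finset.sum_neg_distrib]; rwa [abs_of_nonpos h0] at hrk
  calc P.real {ω | ∃ k, k ≤ N ∧ r ≤ |∑ i ∈ Finset.range k, D i ω|}
      ≤ P.real ({ω | ∃ k, k ≤ N ∧ r ≤ ∑ i ∈ Finset.range k, D i ω} ∪ {ω | ∃ k, k ≤ N ∧ r ≤ ∑ i ∈ Finset.range k, -D i ω}) :=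
        measureReal_mono hsub
    _ ≤ P.real {ω | ∃ k, k ≤ N ∧ r ≤ ∑ i ∈ Finset.range k, D i ω} + P.real {ω | ∃ k, k ≤ N ∧ r ≤ ∑ i ∈ Finset.range k, -D i ω} :=
        measureReal_union_le _ _
    _ ≤ Real.exp (-r ^ 2 / (2 * (N * B ^ 2))) + Real.exp (-r ^ 2 / (2 * (N * B ^ 2))) := add_le_add h₁ h₂
    _ = 2 * Real.exp (-r ^ 2 / (2 * (N * B ^ 2))) := by ring

end Summit.QuantumFields.YangMills.Theorems.ColdStartUniversality

end
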